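import Summits.QuantumFields.BalabanUV.T4Continuum.Spine.NE1p.DressedWindowScheduleWin
import Summits.QuantumFields.BalabanUV.T4Continuum.Support.T4TrajectoryDensityFreshMargin

/-!
# T⁴ programme, spine estimate NE1′ (node O3b/H2) — the window schedule for the ASSEMBLED transport leaf with per-step chart and
# slice windows, and its CUTOFF-FREE witness (swarm row «S1-win» concluded; located findings F-ne1pleaf08-1 ∕ F-ne1pleaf04-1)

Cell `pub-balaban`, sub-cell `t4`, BINDER-OWNERS row NE1′, formalisation swarm `b2b-balaban-t4-ne1p-formalise-*`, seat
`b2b-balaban-t4-ne1p-formalise-leaf-04` (rows S1 p212498, S1b p212785, S1d p213367); tree target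
`Summits/QuantumFields/BalabanUV/T4Continuum/Spine/NE1p/`; ADDITIVE — imports row S1d's `Spine/NE1p/DressedWindowScheduleWin` and
`Support/T4TrajectoryDensityFreshMargin` (`bondBall_complexMargin`) ONLY; modifies nothing.

WHAT.  Row S1d's `WindowScheduleWin` serves END-F-win ∕ END-F-swin with `hP` DISPLAYED.  The ASSEMBLED leaf (END-F′-mod-swin,
`Spine/NE1p/DressedTransportAssembledModSliceWin`, over `Support/T4TrajectoryDensityAssemblyModSliceWin`) has, beyond END-F-swin's
nine geometric binders, the live generations' radius bookkeeping (`hrs_birth`/`hrs_step`/`hrs_dec`/`hmargin` — orderings only, no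
floor), the cross-family nestings `hN1x` ∕ `hN2cx` — the latter now asked only for directions `latN pd ≤ wk b k′ (k+1)` — and the
cross-family window order `hwkx`.  §1 **`WindowScheduleModWin r w`** extends `WindowScheduleWin r w` by the margin radii `ϱ₁ k`
(`ϱc k < ϱ₁ k ≤ r`, `ϱ₁ (k+1) ≤ ϱc k`) and THE FULL GAP `ρw (k+1) + wc (k+1) + ϱ₁ k + σ k ≤ ρw k` — per-step chart window, complex
margin and fluctuation, NO uniform `w`, NO floor.  §2 the genuinely new dischargers (`hN2cx` in the per-step form via
`bondBall_complexMargin`, `hwkx`, the slice-radius bookkeeping `sliceRadius`); the END-F-swin-type binders come from row S1d through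
the parent projection `W.toWindowScheduleWin` BY NAME.  §3 **THE CUTOFF-FREE WITNESS** `WindowScheduleModWin.geometric`: `σ k =
σ₀q^k`, `wc k = 2σ₀q^k`, `ϱc k = ϱ₀q^{k+1}`, `ϱ₁ k = ϱ₀q^k`, `ρw k = ρ∞ + C·q^k` with `C = ((1+2q)σ₀ + ϱ₀)/(1−q)` — the full gap holds
with EQUALITY, the birth window is `ρ∞ + C` (FINITE, CUTOFF-FREE: `geometric_birthWindow`, `geometric_window_le/ge`), the (w4)
ratio is the constant `2σ₀/(ϱ₀q)` (`geometric_ratio`), and `geometric_consumption` records `Σ_{k<K}(wc (k+1) + ϱ₁ k + σ k) ≤ C`.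
CONTRAST (the located findings in one line): with the uniform slice window the same bookkeeping costs `K·w` (`WindowSchedule.window_budget`,
F-ne1pleaf08-1 (4) ∕ F-ne1pleaf04-1), with a uniform radius floor `K·(w + r_*)` (`DressedTransportScheduled.floor_window_budget`,
F-ne1pleaf08-1 (3)); here neither survives.

HONEST FRAMING.  Rung (B)+1 bookkeeping on ONE finite four-torus of fixed physical size — NOT infinite volume, NOT a mass gap,
NOT OS on ℝ⁴, NOT the Clay problem, NOT summit progress.  NE1′ is NOT PRINTED and NOT PROVED; this file reads «the assembled
leaf's window bookkeeping ⇐ a schedule with cutoff-free birth window», never «NE1′ proved».  [folklore] lattice geometry and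
arithmetic, 0 sorry, 0 citations used as facts, no `def … : Prop`; the schedule is a BINDER's witness in the lineage's ONE-FRAME
bond-ball model — no radius or window of Bałaban's ([Balaban1989LargeFieldI] p. 190, (1.27) p. 187: printed TYPE only) is
asserted, and whether geometric data fit inside the printed windows along a family's history is (w3)⁺'s located content
(OWNER-ANSWERS-g23 §F/§G), untouched; the estimate binders ((w1) `hsl`, H2, (w2-act) `hB`/`hE`, (w4)'s constant, (I4′) `hδf`/
`hrate`/`hpairx`, attainment, invariance) stay displayed and their joint cutoff-free satisfiability on Bałaban's densities is the
wall, not decided here.  Spine PROVED 0∕9 unchanged.  HONEST DEPENDENCY: continuum YM on T⁴ ⇐ BetaPertH ∧ nine spine estimates (0/9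
proved); BetaPertH ⇐ (D1) ∧ (D4) ∧ CAP+tail; G-an2-4 gates asym, D1 and NE2/3/4.
-/

noncomputable section

namespace Summit.QuantumFields.BalabanUV.T4Continuum.NE1p.DressedWindowScheduleModWin

open MeasureTheory Set Metric Finset
open scoped BigOperators
open Literature.MathematicalPhysics.QuantumFieldTheory.Balaban1983to89
open Literature.MathematicalPhysics.QuantumFieldTheory.Balaban1983to89.T4TermFormat
open Literature.MathematicalPhysics.QuantumFieldTheory.Balaban1983to89.T4TrajectoryModulus
open T4BlockTransport (Fld NDir latMove latN)
open T4TrajectoryDensity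
open Summit.QuantumFields.BalabanUV.T4Continuum.T4TrajectoryDensityDressed
open Summit.QuantumFields.BalabanUV.T4Continuum.NE1p.DressedWindowScheduleWin

/-! ## §1 The schedule of the assembled leaf: per-step chart windows AND complex margins in the gap -/

/-- **A WINDOW SCHEDULE FOR THE ASSEMBLED LEAF** [data + hypothesis shapes]: a `WindowScheduleWin r w` (window radii `ρw k`,
fluctuation radii `σ k`, chart radii `ϱc k`, per-step chart ∕ slice windows `wc k`) together with the margin radii `ϱ₁ k` of the
complex chart motions (`ϱc k < ϱ₁ k ≤ r`, `ϱ₁ (k+1) ≤ ϱc k` — orderings only, NO floor) and THE FULL GAP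
`ρw (k+1) + wc (k+1) + ϱ₁ k + σ k ≤ ρw k`: the window of step `k+1`, moved by a chart motion of bound `wc (k+1)` over the whole
tube of radius `ϱ₁ k / latN pd` and translated by a step-`k` fluctuation, lies in the window of step `k`.  A BINDER of the
instantiation; NOT asserted for Bałaban's windows. [folklore] -/
structure WindowScheduleModWin (r w : ℝ) extends WindowScheduleWin r w where
  /-- margin radius of the complex chart motions at step `k` -/
  ϱ₁ : ℕ → ℝ
  hϱc₁ : ∀ k, ϱc k < ϱ₁ k
  hϱ₁r : ∀ k, ϱ₁ k ≤ r
  hϱ₁c : ∀ k, ϱ₁ (k + 1) ≤ ϱc k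
  /-- THE FULL GAP: chart window, complex margin and fluctuation of the next met step -/
  hgapx : ∀ k, ρw (k + 1) + wc (k + 1) + ϱ₁ k + σ k ≤ ρw k

namespace WindowScheduleModWin

variable {r w : ℝ} (W : WindowScheduleModWin r w)

/-- [arith] [folklore] Margin radii are positive. -/
theorem ϱ₁_pos' (k : ℕ) : 0 < W.ϱ₁ k := (W.hϱc k).trans (W.hϱc₁ k)

/-- [arith] [folklore] Chart radii decrease strictly. -/
theorem ϱc_succ_lt (k : ℕ) : W.ϱc (k + 1) < W.ϱc k := (W.hϱc₁ (k + 1)).trans_le (W.hϱ₁c k)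

/-- **THE SLICE RADIUS OF A GENERATION** born at step `k″`, at step `k` [data]: `r` at birth, afterwards the chart radius granted
at the previous step. [folklore] -/
def sliceRadius (W : WindowScheduleModWin r w) (k'' k : ℕ) : ℝ := if k'' < k then W.ϱc (k - 1) else r

/-- [folklore] At birth: `r`. -/
@[simp] theorem sliceRadius_birth (k'' : ℕ) : W.sliceRadius k'' k'' = r := by simp [sliceRadius]

/-- [folklore] After step `k ≥ k″`: the chart radius granted at `k`. -/
theorem sliceRadius_step {k'' k : ℕ} (h : k'' ≤ k) : W.sliceRadius k'' (k + 1) = W.ϱc k := by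
  simp [sliceRadius, Nat.lt_succ_of_le h]

/-- [folklore] The chart radius of step `k` is strictly below every current slice radius. -/
theorem ϱc_lt_sliceRadius (k'' k : ℕ) : W.ϱc k < W.sliceRadius k'' k := by
  unfold sliceRadius
  split_ifs with h
  · obtain ⟨j, rfl⟩ := Nat.exists_eq_add_of_lt h
    simpa [Nat.add_assoc] using W.ϱc_succ_lt (k'' + j)
  · exact (W.hϱc₁ k).trans_le (W.hϱ₁r k)

/-- [folklore] The margin radius of step `k` is below every current slice radius. -/
theorem ϱ₁_le_sliceRadius (k'' k : ℕ) : W.ϱ₁ k ≤ W.sliceRadius k'' k := by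
  unfold sliceRadius
  split_ifs with h
  · obtain ⟨j, rfl⟩ := Nat.exists_eq_add_of_lt h
    simpa [Nat.add_assoc] using W.hϱ₁c (k'' + j)
  · exact W.hϱ₁r k

/-- **THE CONSUMPTION OF THE FULL GAP** [arith]: `Σ_{k<K} (wc (k+1) + ϱ₁ k + σ k) ≤ ρw 0 − ρw K` — what the birth window must
hold beyond the final window is exactly the summed per-step data; cutoff-free as soon as the data are summable (§3). [folklore] -/
theorem consumption_le' (K : ℕ) : ∑ k ∈ Finset.range K, (W.wc (k + 1) + W.ϱ₁ k + W.σ k) ≤ W.ρw 0 - W.ρw K := by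
  induction K with
  | zero => simp
  | succ K ih =>
    rw [Finset.sum_range_succ]
    have h := W.hgapx K
    linarith

end WindowScheduleModWin

/-! ## §2 The new dischargers (the END-F-swin-type binders come from row S1d through `W.toWindowScheduleWin`) -/

section Binders

variable {r w : ℝ} (W : WindowScheduleModWin r w)
variable {B : T4TermFormat.Booking} {R : Type*} [NormedRing R] [NormedAlgebra ℂ R] {d : ℕ}

/-- **`hwkx`** of the assembled leaf [folklore]: the produced slice's window `wc (k+1)` is below every live generation's current
window `wc k` (step-indexed schedule: `hwc_anti`). -/
theorem hwkx_of_schedule (Sg : ℕ → B.Birth → Finset (B.Birth × ℕ)) :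
    ∀ (b : B.Birth) (k' k : ℕ), B.birthScale b ≤ k' → k' ≤ k → ∀ p ∈ Sg k b, W.wc (k + 1) ≤ W.wc k :=
  fun _ _ k _ _ _ _ => W.hwc_anti k

/-- **`hN2cx` IN THE PER-STEP FORM** [folklore] (CROSS-FAMILY COMPLEX MARGIN (N2ᶜ), directions `≤ wc (k+1)` only): the step-`(k+1)`
window moved along a declared direction of bound `≤ wc (k+1)` over the whole tube of radius `ϱ₁ k / latN pd` and translated by the
reference fluctuation `z₁ b k ∈ D b k` lies in the step-`k` window of every live generation — `bondBall_complexMargin` on THE FULL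
GAP.  (Row S1's `hN2cx_of_schedule` is the uniform-`w` form; this is the one whose consumption is summable.) -/
theorem hN2cx_swin_of_schedule (Sg : ℕ → B.Birth → Finset (B.Birth × ℕ)) {z₁ : B.Birth → ℕ → Fld d R}
    (hz₁ : ∀ b k, z₁ b k ∈ (bondBall d (W.σ k) : Set (Fld d R))) :
    ∀ (b : B.Birth) (k' k : ℕ), B.birthScale b ≤ k' → k' ≤ k →
      ∀ p ∈ Sg k b, ∀ U₀ ∈ (bondBall d (W.ρw (k + 1)) : Set (Fld d R)), ∀ pd : NDir d R, 0 < latN pd →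
        latN pd ≤ W.wc (k + 1) →
        ∀ t ∈ tube (W.ϱ₁ k / latN pd), latMove U₀ pd t + z₁ b k ∈ (bondBall d (W.ρw k) : Set (Fld d R)) :=
  fun b _ k _ _ _ _ U₀ hU₀ pd hpd hpdw t ht =>
    bondBall_complexMargin (W.ϱ₁_pos' k).le (W.hgapx k) U₀ hU₀ pd hpd hpdw t ht (z₁ b k) (hz₁ b k)

/-- **`hmargin`** of the assembled leaf over `sliceRadius` [folklore]: `ϱc k < ϱ₁ k`, `0 < ϱ₁ k`, and `ϱ₁ k` below every current
slice radius (for a step-indexed schedule: of ANY generation). -/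
theorem hmargin_mod_of_schedule (Sg : ℕ → B.Birth → Finset (B.Birth × ℕ)) :
    ∀ (b : B.Birth) (k' k : ℕ), B.birthScale b ≤ k' → k' ≤ k →
      W.ϱc k < W.ϱ₁ k ∧ 0 < W.ϱ₁ k ∧ ∀ p ∈ Sg k b, W.ϱ₁ k ≤ W.sliceRadius p.2 k :=
  fun _ _ k _ _ => ⟨W.hϱc₁ k, W.ϱ₁_pos' k, fun p _ => W.ϱ₁_le_sliceRadius p.2 k⟩

end Binders

/-! ## §3 The cutoff-free witness -/

namespace WindowScheduleModWin

/-- **A GEOMETRIC SCHEDULE FOR THE ASSEMBLED LEAF** [decided toy]: ratio `0 < q < 1`, fluctuation scale `σ₀ > 0` with `2σ₀ ≤ w`,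
radius scale `0 < ϱ₀ ≤ r`, final window `ρ∞`: `σ k = σ₀q^k`, `wc k = 2σ₀q^k`, `ϱc k = ϱ₀q^{k+1}`, `ϱ₁ k = ϱ₀q^k`,
`ρw k = ρ∞ + ((1+2q)σ₀ + ϱ₀)/(1−q)·q^k` — the full gap holds with equality. [folklore] -/
def geometric (r w q σ₀ ϱ₀ ρinf : ℝ) (hq0 : 0 < q) (hq1 : q < 1) (hσ₀ : 0 < σ₀) (hσ₀w : 2 * σ₀ ≤ w) (hϱ₀ : 0 < ϱ₀)
    (hϱ₀r : ϱ₀ ≤ r) : WindowScheduleModWin r w where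
  ρw k := ρinf + ((1 + 2 * q) * σ₀ + ϱ₀) / (1 - q) * q ^ k
  σ k := σ₀ * q ^ k
  ϱc k := ϱ₀ * q ^ (k + 1)
  wc k := 2 * σ₀ * q ^ k
  ϱ₁ k := ϱ₀ * q ^ k
  hσ k := by positivity
  hσwc k := le_of_eq (by ring)
  hwcw k := by
    have h : q ^ k ≤ 1 := pow_le_one₀ hq0.le hq1.le
    nlinarith
  hwc_anti k := by
    have h : q ^ (k + 1) ≤ q ^ k := pow_le_pow_of_le_one hq0.le hq1.le (Nat.le_succ k)
    nlinarith
  hϱc k := by positivity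
  hgap k := by
    have h1 : (1 : ℝ) - q ≠ 0 := by linarith
    have hϱ : 0 ≤ ϱ₀ * q ^ k := by positivity
    have e : ρinf + ((1 + 2 * q) * σ₀ + ϱ₀) / (1 - q) * q ^ (k + 1) + 2 * σ₀ * q ^ (k + 1) + ϱ₀ * q ^ k + σ₀ * q ^ k =
        ρinf + ((1 + 2 * q) * σ₀ + ϱ₀) / (1 - q) * q ^ k := by
      rw [pow_succ]
      field_simp
      ring
    linarith [e.le]
  hϱc₁ k := by
    have h : q ^ (k + 1) < q ^ k := pow_lt_pow_right_of_lt_one₀ hq0 hq1 (Nat.lt_succ_self k)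
    nlinarith
  hϱ₁r k := by
    have h : q ^ k ≤ 1 := pow_le_one₀ hq0.le hq1.le
    nlinarith
  hϱ₁c k := le_of_eq (by ring)
  hgapx k := by
    have h1 : (1 : ℝ) - q ≠ 0 := by linarith
    have e : ρinf + ((1 + 2 * q) * σ₀ + ϱ₀) / (1 - q) * q ^ (k + 1) + 2 * σ₀ * q ^ (k + 1) + ϱ₀ * q ^ k + σ₀ * q ^ k =
        ρinf + ((1 + 2 * q) * σ₀ + ϱ₀) / (1 - q) * q ^ k := by
      rw [pow_succ]
      field_simp
      ring
    exact e.le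

/-- [decided toy] **THE BIRTH WINDOW OF THE ASSEMBLED LEAF'S SCHEDULE IS CUTOFF-FREE**: `ρw 0 = ρ∞ + ((1+2q)σ₀ + ϱ₀)/(1−q)`. [folklore] -/
theorem geometric_birthWindow {r w q σ₀ ϱ₀ ρinf : ℝ} (hq0 : 0 < q) (hq1 : q < 1) (hσ₀ : 0 < σ₀) (hσ₀w : 2 * σ₀ ≤ w)
    (hϱ₀ : 0 < ϱ₀) (hϱ₀r : ϱ₀ ≤ r) :
    (geometric r w q σ₀ ϱ₀ ρinf hq0 hq1 hσ₀ hσ₀w hϱ₀ hϱ₀r).ρw 0 = ρinf + ((1 + 2 * q) * σ₀ + ϱ₀) / (1 - q) := by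
  show ρinf + ((1 + 2 * q) * σ₀ + ϱ₀) / (1 - q) * q ^ 0 = _
  rw [pow_zero, mul_one]

/-- [decided toy] Every window lies between the final window `ρ∞` and the birth window — at EVERY step, for EVERY number of met
steps (contrast `WindowSchedule.window_budget`'s `K·w` and `DressedTransportScheduled.floor_window_budget`'s `K·(w + r_*)`). [folklore] -/
theorem geometric_window_bounds {r w q σ₀ ϱ₀ ρinf : ℝ} (hq0 : 0 < q) (hq1 : q < 1) (hσ₀ : 0 < σ₀) (hσ₀w : 2 * σ₀ ≤ w)
    (hϱ₀ : 0 < ϱ₀) (hϱ₀r : ϱ₀ ≤ r) (k : ℕ) :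
    ρinf ≤ (geometric r w q σ₀ ϱ₀ ρinf hq0 hq1 hσ₀ hσ₀w hϱ₀ hϱ₀r).ρw k ∧
      (geometric r w q σ₀ ϱ₀ ρinf hq0 hq1 hσ₀ hσ₀w hϱ₀ hϱ₀r).ρw k ≤ ρinf + ((1 + 2 * q) * σ₀ + ϱ₀) / (1 - q) := by
  show ρinf ≤ ρinf + ((1 + 2 * q) * σ₀ + ϱ₀) / (1 - q) * q ^ k ∧
    ρinf + ((1 + 2 * q) * σ₀ + ϱ₀) / (1 - q) * q ^ k ≤ ρinf + ((1 + 2 * q) * σ₀ + ϱ₀) / (1 - q)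
  have hc : 0 ≤ ((1 + 2 * q) * σ₀ + ϱ₀) / (1 - q) := div_nonneg (by positivity) (by linarith)
  have h : q ^ k ≤ 1 := pow_le_one₀ hq0.le hq1.le
  have hqk : 0 ≤ q ^ k := by positivity
  constructor <;> nlinarith

/-- [decided toy] The zero background lies in every window when `0 ≤ ρ∞` — at every step, with no condition on the cutoff. [folklore] -/
theorem geometric_zero_mem_window {R : Type*} [NormedRing R] {d : ℕ} {r w q σ₀ ϱ₀ ρinf : ℝ} (hq0 : 0 < q) (hq1 : q < 1)
    (hσ₀ : 0 < σ₀) (hσ₀w : 2 * σ₀ ≤ w) (hϱ₀ : 0 < ϱ₀) (hϱ₀r : ϱ₀ ≤ r) (hρ : 0 ≤ ρinf) (k : ℕ) :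
    (0 : Fld d R) ∈ (bondBall d ((geometric r w q σ₀ ϱ₀ ρinf hq0 hq1 hσ₀ hσ₀w hϱ₀ hϱ₀r).ρw k) : Set (Fld d R)) := by
  have h0 := hρ.trans (geometric_window_bounds hq0 hq1 hσ₀ hσ₀w hϱ₀ hϱ₀r k).1
  intro x ν
  simpa using h0

/-- [decided toy] **THE (w4) RATIO IS A CUTOFF-FREE CONSTANT**: `θ/ϱ = 2σ₀q^k/(ϱ₀q^{k+1}) = 2σ₀/(ϱ₀q)` at every step, so the
domination binder holds with the constant profile `α := fun _ => e³·(1 + 4·(2σ₀/(ϱ₀q)))` (row S3's `alphaCell (2σ₀/(ϱ₀q))`). [folklore] -/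
theorem geometric_ratio {r w q σ₀ ϱ₀ ρinf : ℝ} (hq0 : 0 < q) (hq1 : q < 1) (hσ₀ : 0 < σ₀) (hσ₀w : 2 * σ₀ ≤ w)
    (hϱ₀ : 0 < ϱ₀) (hϱ₀r : ϱ₀ ≤ r) (k : ℕ) :
    4 * (2 * (geometric r w q σ₀ ϱ₀ ρinf hq0 hq1 hσ₀ hσ₀w hϱ₀ hϱ₀r).σ k) /
        (geometric r w q σ₀ ϱ₀ ρinf hq0 hq1 hσ₀ hσ₀w hϱ₀ hϱ₀r).ϱc k = 4 * (2 * σ₀ / (ϱ₀ * q)) := by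
  show 4 * (2 * (σ₀ * q ^ k)) / (ϱ₀ * q ^ (k + 1)) = 4 * (2 * σ₀ / (ϱ₀ * q))
  have hq : q ≠ 0 := hq0.ne'
  have hϱ : ϱ₀ ≠ 0 := hϱ₀.ne'
  have hqk : q ^ k ≠ 0 := pow_ne_zero k hq
  rw [pow_succ]
  field_simp

/-- [decided toy] Hence the domination binder of the assembled leaf along the geometric schedule, with a CONSTANT cutoff-free
profile. [folklore] -/
theorem geometric_hdom {r w q σ₀ ϱ₀ ρinf : ℝ} (hq0 : 0 < q) (hq1 : q < 1) (hσ₀ : 0 < σ₀) (hσ₀w : 2 * σ₀ ≤ w)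
    (hϱ₀ : 0 < ϱ₀) (hϱ₀r : ϱ₀ ≤ r) {B : T4TermFormat.Booking} :
    ∀ k, k + 1 ≤ B.K →
      Real.exp 3 * (1 + 4 * (2 * (geometric r w q σ₀ ϱ₀ ρinf hq0 hq1 hσ₀ hσ₀w hϱ₀ hϱ₀r).σ k) /
        (geometric r w q σ₀ ϱ₀ ρinf hq0 hq1 hσ₀ hσ₀w hϱ₀ hϱ₀r).ϱc k) ≤
      (fun _ : ℕ => Real.exp 3 * (1 + 4 * (2 * σ₀ / (ϱ₀ * q)))) k :=
  fun k _ => by rw [geometric_ratio hq0 hq1 hσ₀ hσ₀w hϱ₀ hϱ₀r k]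

/-- [decided toy] **TOTAL CONSUMPTION IS CUTOFF-FREE**: along the geometric schedule `Σ_{k<K} (wc (k+1) + ϱ₁ k + σ k) ≤
((1+2q)σ₀ + ϱ₀)/(1−q)` for EVERY `K`. [folklore] -/
theorem geometric_consumption {r w q σ₀ ϱ₀ ρinf : ℝ} (hq0 : 0 < q) (hq1 : q < 1) (hσ₀ : 0 < σ₀) (hσ₀w : 2 * σ₀ ≤ w)
    (hϱ₀ : 0 < ϱ₀) (hϱ₀r : ϱ₀ ≤ r) (K : ℕ) :
    ∑ k ∈ Finset.range K,
        ((geometric r w q σ₀ ϱ₀ ρinf hq0 hq1 hσ₀ hσ₀w hϱ₀ hϱ₀r).wc (k + 1) +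
          (geometric r w q σ₀ ϱ₀ ρinf hq0 hq1 hσ₀ hσ₀w hϱ₀ hϱ₀r).ϱ₁ k +
          (geometric r w q σ₀ ϱ₀ ρinf hq0 hq1 hσ₀ hσ₀w hϱ₀ hϱ₀r).σ k) ≤
      ((1 + 2 * q) * σ₀ + ϱ₀) / (1 - q) := by
  have h := (geometric r w q σ₀ ϱ₀ ρinf hq0 hq1 hσ₀ hσ₀w hϱ₀ hϱ₀r).consumption_le' K
  have hb := (geometric_window_bounds hq0 hq1 hσ₀ hσ₀w hϱ₀ hϱ₀r (ρinf := ρinf) K).1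
  have h0 := geometric_birthWindow hq0 hq1 hσ₀ hσ₀w hϱ₀ hϱ₀r (ρinf := ρinf)
  linarith

end WindowScheduleModWin

end Summit.QuantumFields.BalabanUV.T4Continuum.NE1p.DressedWindowScheduleModWin

end
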